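import Summits.HodgeConjecture.HodgeConjecture.Theorems.MarkmanPartnerTransportHilbertSquareCycleInducedTransport
import Summits.HodgeConjecture.HodgeConjecture.Theorems.MarkmanPartnerTransportPartnerTransportTranscendental
import Summits.HodgeConjecture.HodgeConjecture.Theorems.MarkmanPartnerTransportPartnerTransportInverse

/-!
# Route MarkmanPartnerTransport · crux `LowPicardRealMultiplication` (#5, stmt-HodgeConjecture-19653) —
# `End_Hdg T(S) = ℚ[t]` TRANSPORTS TO THE HILBERT SQUARE, and the `X`-side F4 FIRES on Hilbert squares

Sequel to `…HilbertSquareCycleInducedTransport` (cycle-inducedness of `t` on `H²(S)` ⟹ cycle-inducedness of the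
transported `t_H = [θ]_* ∘ t ∘ π` on `H²(H)`, `H = S^{[2]}` Beauville's marked Hilbert square with algebraic
incidence `θ`, `π` the Beauville–Bogomolov retraction). Here the remaining inputs of the `X`-side F4
`hodgeConjectureFor_of_cycleInducedGenerator` (crux #5's closed form: a marked `K3^{[2]}`-type fourfold whose
transcendental rational Hodge endomorphisms are the rational polynomials in ONE rational, type-preserving,
cycle-induced `t`) are transported from `S` to `H`:

* §1 `transported_apply`, `transported_pow_apply` (`t_H^k = [θ]_* t^k π` on `[θ]_* H²(S)`),
  `isRationalClass_transported`, `isOfHodgeType_transported` (all bidegrees; `(0,2)` by conjugation);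
* §2 **`transported_generates`** — `TranscendentalEndomorphismsGeneratedBy S t` («`End_Hdg T(S)_ℚ = ℚ[t|_T]`»)
  ⟹ the `hgen` clause of the `X`-side F4 for `(H, φ_H, t_H)`: every rational Hodge endomorphism `f` of `H²(H)`
  killing `N¹(H)` with `q`-transcendental image is `Σ aᵢ t_Hⁱ` (`aᵢ ∈ ℚ`) on `T_q(H)`: `f_S := π ∘ f ∘ [θ]_*` is
  admissible on `S` (`[θ]_* N¹(S) ⊆ N¹(H)`, `corrAction_mem_algebraicClasses_of_cupProductFact`; `incidence_*` ∕
  `retraction_*`), so `f_S = Σ aᵢ tⁱ` on `T(S)`, and `T_q(H) = [θ]_* T(S)` (`exists_incidence_eq_of_bbfTransc`);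
* §3 **`hodgeConjectureFor_hilbertSquare_of_cycleInducedGenerator`** (+ `_of_charlesMarkman`) — HC⁴(H) for
  Beauville's marked Hilbert square of a marked projective K3 surface carrying a rational, type-preserving,
  CYCLE-INDUCED, GENERATING `t`, by the `X`-side F4 — mod {Verbitsky–Guan, O'Grady, `QInvAlgebraic` ∕ Charles–Markman};
* §4 `hodgeConjectureFor_hilbertSquare_of_cycleInducedGenerator_of_facts` — the same for EVERY representing pair
  of `Hilb²(S)` from the fact `Beauville1983_hilbertSquare_markedIncidence` (`IsHilbertSchemeOfPoints.exists_iso`,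
  `HodgeConjectureFor.of_surjective`).

HONEST STATUS. A SECOND FACT ROAD to a conclusion the tree already has (`hodgeConjectureFor_hilbertSquare_of_square`,
`…_of_rmSpreadFamily`: HC⁴(S × S) ⇒ HC⁴(S^{[2]}) mod Beauville–Fogarty; HC⁴(S × S) fact-free for cycle-induced RM,
`SquareOfGenerator.hodgeConjectureFor_tensor_self_of_isCycleInducedRMK3`). Value: crux #5's `X`-side closed form
is INHABITED (it fires on every Hilbert square of a cycle-induced-RM K3) and its open input at Hilbert squares is
the K3-side input. NOT a new case; credits nothing; crux #5 and HC stay open. No definition, no sorry, no new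
named fact. Prover seat hodge-nonav-19716-p2 (gen 4), `--supports stmt-HodgeConjecture-19653`.

References: Beauville, J. Differential Geom. 18 (1983) §6, §9; O'Grady, Commun. Contemp. Math. 10 (2008) §3;
Charles–Markman, Compos. Math. 149 (2013); Markman, Compos. Math. 160 (2024); van Geemen–Schütt, Forum Math.
Sigma 13 (2025) e2; Zarhin, J. reine angew. Math. 341 (1983); Voisin, *Hodge Theory I* (2002) Cor. 6.12.
-/

noncomputable section

set_option linter.dupNamespace false

open Module CategoryTheory MonoidalCategory CartesianMonoidalCategory
open Literature.AlgebraicTopology.SingularHomology Literature.Geometry.Kaehler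
open Literature.AlgebraicGeometry Literature.AlgebraicGeometry.Motives Literature.AlgebraicGeometry.HodgeTheory
open Literature.AlgebraicGeometry.Hyperkaehler Literature.AlgebraicGeometry.Surfaces
open Summit.HodgeConjecture.HodgeConjecture.Theorems.NikulinTwinTransport
open Summit.HodgeConjecture.HodgeConjecture.Theorems.MarkmanPartnerTransport.BBFPositivity

namespace Summit.HodgeConjecture.HodgeConjecture.Theorems.MarkmanPartnerTransport.PartnerLattice

/-- `MarkedK3[S, η, p, x]`: the six K3 marking clauses, VERBATIM those of `Surfaces.Huybrechts_K3_marking_exists`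
and of `Beauville1983_hilbertSquare_markedIncidence`. Local notation only. [cite: Huybrechts2016K3, Ch. 1 Prop. 3.5] -/
local notation3 (prettyPrint := false) "MarkedK3[" S ", " η ", " p ", " x "]" =>
  (IsIntegralClass p ∧
    (∀ q : complexBetti S (2 * 2), IsIntegralClass q → ∃ n : ℤ, q = n • p) ∧
    (∀ c : complexBetti S (2 * 1), IsIntegralClass c ↔ ∃ v : K3Index → ℤ, η c = fun i => (v i : ℂ)) ∧
    (∀ a b : complexBetti S (2 * 1),
        cupProduct (rfl : 2 * 1 + 2 * 1 = 2 * 2) a b = k3Form (η a) (η b) • p) ∧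
    IsOfHodgeType 2 S (2 * 1) 2 0 (LinearEquiv.symm η x) ∧
    (∀ τ : complexBetti S (2 * 1), IsOfHodgeType 2 S (2 * 1) 2 0 τ → ∃ t : ℂ, τ = t • LinearEquiv.symm η x))

/-- `MarkedK3Sq[X, φ, P, z]`: VERBATIM the `let MarkedK3Sq := …` binder of the route declarations of
MarkmanPartnerTransport (clauses (m1)–(m6)). Local notation only. -/
local notation3 (prettyPrint := false) "MarkedK3Sq[" X ", " φ ", " P ", " z "]" =>
  (((IsIntegralClass P ∧ ∀ Q : complexBetti X (2 * 4), IsIntegralClass Q → ∃ n : ℤ, Q = n • P) ∧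
    (∀ c : complexBetti X 2, IsIntegralClass c ↔ ∃ v : K3HilbertIndex → ℤ, φ c = fun i => (v i : ℂ)) ∧
    (∀ a : complexBetti X 2, cupPowTwo a 4 = ((3 : ℂ) * (k3HilbertForm 2 (φ a) (φ a)) ^ 2) • P) ∧
    (IsOfHodgeType 4 X 2 2 0 (LinearEquiv.symm φ z) ∧
      ∀ τ : complexBetti X 2, IsOfHodgeType 4 X 2 2 0 τ → ∃ t : ℂ, τ = t • LinearEquiv.symm φ z) ∧
    (∀ c : complexBetti X 2, IsOfHodgeType 4 X 2 1 1 c ↔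
      (k3HilbertForm 2 (φ c) z = 0 ∧ k3HilbertForm 2 (φ c) (star z) = 0)) ∧
    (k3HilbertForm 2 z z = 0 ∧ 0 < (k3HilbertForm 2 (star z) z).re)))

/-- `Transported[hH, hS, θ, η, φH, t] = [θ]_* ∘ t ∘ π`, `π = η⁻¹ ∘ (· ∘ Sum.inl) ∘ φ_H` (VERBATIM the local
notation of `…HilbertSquareCycleInducedTransport`). Local notation only. -/
local notation3 (prettyPrint := false) "Transported[" hH ", " hS ", " θ ", " η ", " φH ", " t "]" =>
  (corrAction complexOrientationFamily hH hS (rfl : 2 * 1 + 2 * 2 = 2 + 2 * 2) θ) ∘ₗ t ∘ₗ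
    ((LinearEquiv.symm η : (K3Index → ℂ) →ₗ[ℂ] _) ∘ₗ
      LinearMap.funLeft ℂ ℂ (Sum.inl : K3Index → K3HilbertIndex) ∘ₗ (φH : _ →ₗ[ℂ] (K3HilbertIndex → ℂ)))

variable {S H : SchemeOver ℂ} {η : complexBetti S (2 * 1) ≃ₗ[ℂ] (K3Index → ℂ)} {p : complexBetti S (2 * 2)}
  {x : K3Index → ℂ} {φH : complexBetti H 2 ≃ₗ[ℂ] (K3HilbertIndex → ℂ)} {PH : complexBetti H (2 * 4)}
  {θ : complexBetti (H ⊗ S) (2 * 2)}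

/-! ### §1 The transported endomorphism: formula, powers, rationality, Hodge types -/

/-- `t_H w = [θ]_* (t (π w))`. [cite: Beauville1983, §6 Prop. 6] -/
theorem transported_apply (hS : IsSmoothProjective 2 S) (hH : IsSmoothProjective 4 H)
    (t : complexBetti S (2 * 1) →ₗ[ℂ] complexBetti S (2 * 1)) (w : complexBetti H 2) :
    (Transported[hH, hS, θ, η, φH, t]) w =
      corrAction complexOrientationFamily hH hS (rfl : 2 * 1 + 2 * 2 = 2 + 2 * 2) θ
        (t (η.symm (fun k => φH w (Sum.inl k)))) :=
  rfl

/-- **`t_H^k w = [θ]_* (t^k (π w))` when `[θ]_* (π w) = w`** (`π ∘ [θ]_* = id`). [cite: Beauville1983, §6 Prop. 6] -/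
theorem transported_pow_apply (hS : IsSmoothProjective 2 S) (hH : IsSmoothProjective 4 H)
    (hi : ∀ a : complexBetti S (2 * 1),
      φH (corrAction complexOrientationFamily hH hS (rfl : 2 * 1 + 2 * 2 = 2 + 2 * 2) θ a) = Sum.elim (η a) 0)
    (t : complexBetti S (2 * 1) →ₗ[ℂ] complexBetti S (2 * 1)) {w : complexBetti H 2}
    (hw : corrAction complexOrientationFamily hH hS (rfl : 2 * 1 + 2 * 2 = 2 + 2 * 2) θ
      (η.symm (fun k => φH w (Sum.inl k))) = w) (k : ℕ) :
    ((Transported[hH, hS, θ, η, φH, t]) ^ k) w =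
      corrAction complexOrientationFamily hH hS (rfl : 2 * 1 + 2 * 2 = 2 + 2 * 2) θ
        ((t ^ k) (η.symm (fun k => φH w (Sum.inl k)))) := by
  induction k with
  | zero => rw [pow_zero, pow_zero, Module.End.one_apply, Module.End.one_apply, hw]
  | succ m ih =>
    rw [pow_succ', Module.End.mul_apply, ih, transported_apply, retraction_incidence hi, pow_succ',
      Module.End.mul_apply]

/-- **`t_H` preserves rational classes** if `t` does. [cite: Beauville1983, §6 Prop. 6 and Remarque] -/
theorem isRationalClass_transported (hS : IsK3Surface S) (hH : IsSmoothProjective 4 H)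
    (hηint : ∀ c : complexBetti S (2 * 1), IsIntegralClass c ↔ ∃ v : K3Index → ℤ, η c = fun i => (v i : ℂ))
    (hintH : ∀ c : complexBetti H 2, IsIntegralClass c ↔ ∃ v : K3HilbertIndex → ℤ, φH c = fun i => (v i : ℂ))
    (hi : ∀ a : complexBetti S (2 * 1),
      φH (corrAction complexOrientationFamily hH (IsK3Surface.isSmoothProjective hS)
        (rfl : 2 * 1 + 2 * 2 = 2 + 2 * 2) θ a) = Sum.elim (η a) 0)
    {t : complexBetti S (2 * 1) →ₗ[ℂ] complexBetti S (2 * 1)}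
    (ht_rat : ∀ y, IsRationalClass y → IsRationalClass (t y)) {w : complexBetti H 2} (hw : IsRationalClass w) :
    IsRationalClass ((Transported[hH, IsK3Surface.isSmoothProjective hS, θ, η, φH, t]) w) := by
  rw [transported_apply]
  exact isRationalClass_incidence hS hH hηint hintH hi (ht_rat _ (isRationalClass_retraction hS hH hηint hintH hw))

/-- **`t_H` preserves Hodge types** if `t` does (`(2,0)`, `(1,1)` through `π`, `t`, `[θ]_*`; `(0,2)` by
conjugation, `t_H` being real; other bidegrees are zero). [cite: Beauville1983, §6 Prop. 6] [cite: VoisinHodgeI2002, Cor. 6.12] -/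
theorem isOfHodgeType_transported (hS : IsK3Surface S) (hH : IsSmoothProjective 4 H)
    (hηint : ∀ c : complexBetti S (2 * 1), IsIntegralClass c ↔ ∃ v : K3Index → ℤ, η c = fun i => (v i : ℂ))
    (hcupS : ∀ a b : complexBetti S (2 * 1),
      cupProduct (rfl : 2 * 1 + 2 * 1 = 2 * 2) a b = k3Form (η a) (η b) • p)
    (h20 : IsOfHodgeType 2 S (2 * 1) 2 0 (η.symm x))
    (h20span : ∀ τ : complexBetti S (2 * 1), IsOfHodgeType 2 S (2 * 1) 2 0 τ → ∃ c : ℂ, τ = c • η.symm x)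
    (hxpos : 0 < (k3Form (star x) x).re) (hMH : MarkedK3Sq[H, φH, PH, Sum.elim x 0])
    (hi : ∀ a : complexBetti S (2 * 1),
      φH (corrAction complexOrientationFamily hH (IsK3Surface.isSmoothProjective hS)
        (rfl : 2 * 1 + 2 * 2 = 2 + 2 * 2) θ a) = Sum.elim (η a) 0)
    {t : complexBetti S (2 * 1) →ₗ[ℂ] complexBetti S (2 * 1)}
    (ht_rat : ∀ y, IsRationalClass y → IsRationalClass (t y))
    (ht_typ : ∀ (a b : ℕ) (y : complexBetti S (2 * 1)),
      IsOfHodgeType 2 S (2 * 1) a b y → IsOfHodgeType 2 S (2 * 1) a b (t y))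
    (a b : ℕ) {w : complexBetti H 2} (hw : IsOfHodgeType 4 H 2 a b w) :
    IsOfHodgeType 4 H 2 a b ((Transported[hH, IsK3Surface.isSmoothProjective hS, θ, η, φH, t]) w) := by
  obtain ⟨-, hintH, -⟩ := id hMH
  have hS2 : IsSmoothProjective 2 S := IsK3Surface.isSmoothProjective hS
  have hp0 : p ≠ 0 := generator_ne_zero_of_cupForm hS2 hcupS
  set tH : complexBetti H 2 →ₗ[ℂ] complexBetti H 2 := Transported[hH, hS2, θ, η, φH, t] with htHdef
  have htH : ∀ c, tH c = corrAction complexOrientationFamily hH hS2 (rfl : 2 * 1 + 2 * 2 = 2 + 2 * 2) θ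
      (t (η.symm (fun k => φH c (Sum.inl k)))) := fun c => rfl
  have h1 : ∀ c, IsRationalClass c → IsRationalClass (tH c) := fun c hc =>
    isRationalClass_transported hS hH hηint hintH hi ht_rat hc
  have h20H : ∀ c, IsOfHodgeType 4 H 2 2 0 c → IsOfHodgeType 4 H 2 2 0 (tH c) := fun c hc => by
    rw [htH]
    exact incidence_twoZero hMH h20span hi (ht_typ 2 0 _ (retraction_twoZero hMH h20 hc))
  have h11H : ∀ c, IsOfHodgeType 4 H 2 1 1 c → IsOfHodgeType 4 H 2 1 1 (tH c) := fun c hc => by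
    rw [htH]
    exact incidence_oneOne hS hp0 hηint hcupS h20 hxpos hMH hi
      (ht_typ 1 1 _ (retraction_oneOne hS hp0 hηint hcupS h20 hxpos hMH hc))
  have hconj : ∀ c, tH (conjClass (ComplexPoints H) 2 c) = conjClass (ComplexPoints H) 2 (tH c) :=
    conjClass_map_of_isRationalClass hH hH hintH hintH tH h1
  by_cases hab : a + b = 2
  · have ha2 : a ≤ 2 := by omega
    interval_cases a
    · have hb : b = 2 := by omega
      subst hb
      rw [← conjClass_conjClass (tH w), ← hconj]
      exact (h20H _ (hw.conjClass hH)).conjClass hH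
    · have hb : b = 1 := by omega
      subst hb
      exact h11H w hw
    · have hb : b = 0 := by omega
      subst hb
      exact h20H w hw
  · have hw0 : w = 0 := by
      obtain ⟨A, hA⟩ := hw
      rw [(A.hodgePQ_eq_bot_iff 2 a b).2
          (Literature.NumberTheory.Transcendental.hodgePQ_eq_bot_of_ne (M := A.carrier) hab),
        Submodule.mem_bot] at hA
      exact A.pullback_injective 2 (by rw [hA, map_zero])
    rw [hw0, map_zero]
    exact isOfHodgeType_zero_of_isSmoothProjective nonempty_hodgeModel_holds hH 2 a b


/-! ### §2 `End_Hdg T(S) = ℚ[t]` transports to `End_Hdg T(H) = ℚ[t_H]` -/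

/-- **THE GENERATION CLAUSE TRANSPORTS TO THE HILBERT SQUARE.**  If every rational Hodge endomorphism of
`H²(S)` killing `N¹(S)` with cup-transcendental image is a rational polynomial in `t` on `T(S)`
(`TranscendentalEndomorphismsGeneratedBy S t`, «`End_Hdg T(S)_ℚ = ℚ[t|_T]`»), then every rational Hodge
endomorphism `f` of `H²(H)` killing `N¹(H)` with `q`-transcendental image is the SAME rational polynomial in
`t_H = [θ]_* ∘ t ∘ π` on `T_q(H)` — verbatim the hypothesis `hgen` of the `X`-side F4 for `(H, φ_H, t_H)`
(module docstring §2 for the proof). [cite: Beauville1983, §6 Prop. 6 and Remarque, §9 Lemme 1]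
[cite: Zarhin1983HodgeGroupsK3, Thm. 1.5.1] [cite: GeemenSchutt2023, §2.1] -/
theorem transported_generates (hS : IsK3Surface S) (hH : IsSmoothProjective 4 H)
    (hηint : ∀ c : complexBetti S (2 * 1), IsIntegralClass c ↔ ∃ v : K3Index → ℤ, η c = fun i => (v i : ℂ))
    (hcupS : ∀ a b : complexBetti S (2 * 1),
      cupProduct (rfl : 2 * 1 + 2 * 1 = 2 * 2) a b = k3Form (η a) (η b) • p)
    (h20 : IsOfHodgeType 2 S (2 * 1) 2 0 (η.symm x))
    (h20span : ∀ τ : complexBetti S (2 * 1), IsOfHodgeType 2 S (2 * 1) 2 0 τ → ∃ c : ℂ, τ = c • η.symm x)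
    (hxpos : 0 < (k3Form (star x) x).re) (hMH : MarkedK3Sq[H, φH, PH, Sum.elim x 0])
    (hθ : θ ∈ algebraicClasses (H ⊗ S) 2)
    (hi : ∀ a : complexBetti S (2 * 1),
      φH (corrAction complexOrientationFamily hH (IsK3Surface.isSmoothProjective hS)
        (rfl : 2 * 1 + 2 * 2 = 2 + 2 * 2) θ a) = Sum.elim (η a) 0)
    {t : complexBetti S (2 * 1) →ₗ[ℂ] complexBetti S (2 * 1)} (hgen : TranscendentalEndomorphismsGeneratedBy S t) :
    ∀ f : complexBetti H 2 →ₗ[ℂ] complexBetti H 2, (∀ y, IsRationalClass y → IsRationalClass (f y)) →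
      (∀ (i j : ℕ) y, IsOfHodgeType 4 H 2 i j y → IsOfHodgeType 4 H 2 i j (f y)) →
      (∀ d : complexBetti H 2, d ∈ algebraicClasses H 1 → f d = 0) →
      (∀ y : complexBetti H 2, ∀ d : complexBetti H 2, d ∈ algebraicClasses H 1 →
        k3HilbertForm 2 (φH (f y)) (φH d) = 0) →
      ∃ (n : ℕ) (a : Fin n → ℚ), ∀ y : complexBetti H 2,
        (∀ d : complexBetti H 2, d ∈ algebraicClasses H 1 → k3HilbertForm 2 (φH y) (φH d) = 0) →
        f y = ∑ i : Fin n,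
          ((a i : ℂ) • ((Transported[hH, IsK3Surface.isSmoothProjective hS, θ, η, φH, t]) ^ (i : ℕ)) y) := by
  intro f hfrat hfh hfN hfT
  obtain ⟨-, hintH, -⟩ := id hMH
  have hS2 : IsSmoothProjective 2 S := IsK3Surface.isSmoothProjective hS
  have hp0 : p ≠ 0 := generator_ne_zero_of_cupForm hS2 hcupS
  have hμ : complexOrientationFamily.HasPoincareDuality := hasPoincareDuality_complexOrientationFamily
  set i : complexBetti S (2 * 1) →ₗ[ℂ] complexBetti H 2 :=
    corrAction complexOrientationFamily hH hS2 (rfl : 2 * 1 + 2 * 2 = 2 + 2 * 2) θ with hidef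
  have hi' : ∀ a, φH (i a) = Sum.elim (η a) 0 := hi
  set π : complexBetti H 2 →ₗ[ℂ] complexBetti S (2 * 1) :=
    (η.symm : (K3Index → ℂ) →ₗ[ℂ] complexBetti S (2 * 1)) ∘ₗ
      LinearMap.funLeft ℂ ℂ (Sum.inl : K3Index → K3HilbertIndex) ∘ₗ
      (φH : complexBetti H 2 →ₗ[ℂ] (K3HilbertIndex → ℂ)) with hπdef
  have hπ : ∀ w, π w = η.symm (fun k => φH w (Sum.inl k)) := fun w => rfl
  -- `[θ]_* N¹(S) ⊆ N¹(H)`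
  have hiN : ∀ d ∈ algebraicClasses S 1, i d ∈ algebraicClasses H 1 := fun d hd =>
    corrAction_mem_algebraicClasses_of_cupProductFact Theorems.Voisin2003_cupProduct_algebraicClasses_holds hμ
      hH hS2 (q := 1) rfl (by norm_num) hθ hd
  set fS : complexBetti S (2 * 1) →ₗ[ℂ] complexBetti S (2 * 1) := π ∘ₗ f ∘ₗ i with hfSdef
  have hfS : ∀ c, fS c = π (f (i c)) := fun c => rfl
  have h1 : ∀ c, IsRationalClass c → IsRationalClass (fS c) := fun c hc => by
    rw [hfS, hπ]
    exact isRationalClass_retraction hS hH hηint hintH (hfrat _ (isRationalClass_incidence hS hH hηint hintH hi' hc))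
  have h3 : ∀ d ∈ algebraicClasses S 1, fS d = 0 := fun d hd => by
    rw [hfS, hfN _ (hiN d hd), map_zero]
  have h4 : ∀ (y : complexBetti S (2 * 1)), ∀ d ∈ algebraicClasses S 1,
      cupProduct (rfl : 2 * 1 + 2 * 1 = 2 * 2) (fS y) d = 0 := fun y d hd => by
    have h0 := hfT (i y) (i d) (hiN d hd)
    rw [hi' d, k3HilbertForm_sumElim_zero_right] at h0
    rw [hfS, hπ, hcupS, LinearEquiv.apply_symm_apply, h0, zero_smul]
  have h20S : ∀ c, IsOfHodgeType 2 S (2 * 1) 2 0 c → IsOfHodgeType 2 S (2 * 1) 2 0 (fS c) := fun c hc => by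
    rw [hfS, hπ]
    exact retraction_twoZero hMH h20 (hfh 2 0 _ (incidence_twoZero hMH h20span hi' hc))
  have h11S : ∀ c, IsOfHodgeType 2 S (2 * 1) 1 1 c → IsOfHodgeType 2 S (2 * 1) 1 1 (fS c) := fun c hc => by
    rw [hfS, hπ]
    exact retraction_oneOne hS hp0 hηint hcupS h20 hxpos hMH
      (hfh 1 1 _ (incidence_oneOne hS hp0 hηint hcupS h20 hxpos hMH hi' hc))
  have hconj : ∀ c, fS (conjClass (ComplexPoints S) (2 * 1) c) = conjClass (ComplexPoints S) (2 * 1) (fS c) :=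
    fun c => (conjClass_apply_of_isRationalClass η hηint fS h1 c).symm
  have h2 : ∀ (a b : ℕ) c, IsOfHodgeType 2 S (2 * 1) a b c → IsOfHodgeType 2 S (2 * 1) a b (fS c) := by
    intro a b c hc
    by_cases hab : a + b = 2 * 1
    · have ha2 : a ≤ 2 := by omega
      interval_cases a
      · have hb : b = 2 := by omega
        subst hb
        rw [← conjClass_conjClass (fS c), ← hconj]
        exact (h20S _ (hc.conjClass hS2)).conjClass hS2
      · have hb : b = 1 := by omega
        subst hb
        exact h11S c hc
      · have hb : b = 0 := by omega
        subst hb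
        exact h20S c hc
    · have hc0 : c = 0 := by
        obtain ⟨A, hA⟩ := hc
        rw [(A.hodgePQ_eq_bot_iff (2 * 1) a b).2
            (Literature.NumberTheory.Transcendental.hodgePQ_eq_bot_of_ne (M := A.carrier) hab),
          Submodule.mem_bot] at hA
        exact A.pullback_injective (2 * 1) (by rw [hA, map_zero])
      rw [hc0, map_zero]
      exact isOfHodgeType_zero_of_isSmoothProjective nonempty_hodgeModel_holds hS2 (2 * 1) a b
  obtain ⟨n, a, ha⟩ := hgen fS h1 h2 h3 h4
  refine ⟨n, a, fun w hw => ?_⟩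
  obtain ⟨hπwT, hiπw⟩ := exists_incidence_eq_of_bbfTransc Theorems.Voisin2003_cupProduct_algebraicClasses_holds
    hμ hS hcupS hH hMH hθ hi hw
  obtain ⟨-, hiπfw⟩ := exists_incidence_eq_of_bbfTransc Theorems.Voisin2003_cupProduct_algebraicClasses_holds
    hμ hS hcupS hH hMH hθ hi (hfT w)
  rw [← hidef, ← hπ] at hiπw hiπfw
  rw [← hπ] at hπwT
  have hfw : f w = i (fS (π w)) := by rw [hfS, hiπw, hiπfw]
  rw [hfw, ha (π w) hπwT, map_sum]
  refine Finset.sum_congr rfl fun k _ => ?_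
  rw [map_smul, transported_pow_apply hS2 hH hi t hiπw]
  rfl

/-! ### §3 The `X`-side F4 fires on the Hilbert square -/

/-- **HC⁴ OF THE HILBERT SQUARE BY THE `X`-SIDE F4** (crux #5's closed form is NON-VACUOUS at Hilbert squares).
For a marked projective K3 surface `(S, η, p, x)` (marking clauses `MarkedK3`, `(x̄ · x) > 0`), an endomorphism
`t` of `H²(S)` which is rational, type-preserving, CYCLE-INDUCED (`t = [γ]_*`, `γ ∈ N²H⁴(S ⊗ S)`) and
GENERATING (`TranscendentalEndomorphismsGeneratedBy S t`), and Beauville's marked Hilbert-square data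
(`MarkedK3Sq[H, φ_H, P_H, (x,0)]`, `K3^{[2]}`-type, algebraic incidence `θ` with `φ_H([θ]_* a) = (η a, 0)`):
`HodgeConjectureFor 4 H`, by `hodgeConjectureFor_of_cycleInducedGenerator` applied to `t_H = [θ]_* ∘ t ∘ π`
(rational, type-preserving, cycle-induced by `exists_algebraicClass_corrAction_eq_transport`, generating by
`transported_generates`). Modulo {Verbitsky–Guan, O'Grady, `QInvAlgebraic`}. A SECOND fact road to
`hodgeConjectureFor_hilbertSquare_of_square` (Beauville–Fogarty) — NOT a new case; credits nothing.
[cite: Beauville1983, §6 Prop. 6 and Remarque, §9 Lemme 1] [cite: OGrady2008NumericalK3Square, §3 Claim 3.1]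
[cite: Markman2024, §1.1 Thm. 1.1] [cite: GeemenSchutt2023, §2.1 and §4.8] -/
theorem hodgeConjectureFor_hilbertSquare_of_cycleInducedGenerator
    (hV : VerbitskyGuan_cohomology_K3HilbertSquareType) (hO : OGrady2008_dualBBFClass_algebraic)
    (hQ : QInvAlgebraic) (hS : IsK3Surface S) (hM : MarkedK3[S, η, p, x])
    (hxpos : 0 < (k3Form (star x) x).re) (hH : IsSmoothProjective 4 H) (hK : IsOfK3HilbertSquareType H)
    (hMH : MarkedK3Sq[H, φH, PH, Sum.elim x 0]) (hθ : θ ∈ algebraicClasses (H ⊗ S) 2)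
    (hi : ∀ a : complexBetti S (2 * 1),
      φH (corrAction complexOrientationFamily hH (IsK3Surface.isSmoothProjective hS)
        (rfl : 2 * 1 + 2 * 2 = 2 + 2 * 2) θ a) = Sum.elim (η a) 0)
    (t : complexBetti S (2 * 1) →ₗ[ℂ] complexBetti S (2 * 1))
    (ht_rat : ∀ y, IsRationalClass y → IsRationalClass (t y))
    (ht_typ : ∀ (a b : ℕ) (y : complexBetti S (2 * 1)),
      IsOfHodgeType 2 S (2 * 1) a b y → IsOfHodgeType 2 S (2 * 1) a b (t y))
    (ht_cyc : ∃ γ ∈ algebraicClasses (S ⊗ S) 2, ∀ y : complexBetti S (2 * 1),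
      t y = corrAction complexOrientationFamily (IsK3Surface.isSmoothProjective hS)
        (IsK3Surface.isSmoothProjective hS) (rfl : 2 * 1 + 2 * 2 = 2 * 1 + 2 * 2) γ y)
    (hgen : TranscendentalEndomorphismsGeneratedBy S t) :
    HodgeConjectureFor 4 H := by
  obtain ⟨-, -, hηint, hcupS, h20, h20span⟩ := hM
  have hS2 : IsSmoothProjective 2 S := IsK3Surface.isSmoothProjective hS
  have hMK : IsMarkedK3Hilb 2 H φH PH := isMarkedK3Hilb_of_marked hMH
  have hPH : PH ≠ 0 := generator_ne_zero_of_markedSq hH hMH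
  have hqd : dualBBFClass 2 φH ∈ algebraicClasses H 2 := (hO H hH hK φH PH hMK).1
  obtain ⟨Z, hZ, hZt⟩ := exists_algebraicClass_corrAction_eq_transport hS2 hH hcupS hMK hPH hqd hθ hi ht_cyc
  obtain ⟨-, hintH, -⟩ := id hMH
  have hrat : ∀ y : complexBetti H 2, IsRationalClass y → IsRationalClass ((Transported[hH, hS2, θ, η, φH, t]) y) :=
    fun y hy => isRationalClass_transported hS hH hηint hintH hi ht_rat hy
  have htyp : ∀ (a b : ℕ) (y : complexBetti H 2), IsOfHodgeType 4 H 2 a b y →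
      IsOfHodgeType 4 H 2 a b ((Transported[hH, hS2, θ, η, φH, t]) y) :=
    fun a b y hy => isOfHodgeType_transported hS hH hηint hcupS h20 h20span hxpos hMH hi ht_rat ht_typ a b hy
  have hcyc : ∃ Z ∈ algebraicClasses (H ⊗ H) 4, ∀ y : complexBetti H 2,
      (Transported[hH, hS2, θ, η, φH, t]) y =
        corrAction complexOrientationFamily hH hH (rfl : 2 + 2 * 4 = 2 + 2 * 4) Z y :=
    ⟨Z, hZ, fun y => by rw [hZt y]; rfl⟩
  have hgenH := transported_generates hS hH hηint hcupS h20 h20span hxpos hMH hθ hi hgen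
  exact hodgeConjectureFor_of_cycleInducedGenerator hV hO hQ hH hK hMH _ hrat htyp hcyc hgenH

/-- **The same from the route's published facts** (`QInvAlgebraic` from Charles–Markman 2013 + Verbitsky–Guan,
`qInvAlgebraic_of_charlesMarkman`), modulo {Verbitsky–Guan, O'Grady, Charles–Markman}. Second road; credits
nothing. [cite: CharlesMarkman2013, Thm. 1.1 (§1)] [cite: Beauville1983, §6 Prop. 6] [cite: OGrady2008NumericalK3Square, §3 Claim 3.1] -/
theorem hodgeConjectureFor_hilbertSquare_of_cycleInducedGenerator_of_charlesMarkman
    (hV : VerbitskyGuan_cohomology_K3HilbertSquareType) (hO : OGrady2008_dualBBFClass_algebraic)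
    (hB : CharlesMarkman2013_lefschetzStandard_K3HilbertType) (hS : IsK3Surface S) (hM : MarkedK3[S, η, p, x])
    (hxpos : 0 < (k3Form (star x) x).re) (hH : IsSmoothProjective 4 H) (hK : IsOfK3HilbertSquareType H)
    (hMH : MarkedK3Sq[H, φH, PH, Sum.elim x 0]) (hθ : θ ∈ algebraicClasses (H ⊗ S) 2)
    (hi : ∀ a : complexBetti S (2 * 1),
      φH (corrAction complexOrientationFamily hH (IsK3Surface.isSmoothProjective hS)
        (rfl : 2 * 1 + 2 * 2 = 2 + 2 * 2) θ a) = Sum.elim (η a) 0)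
    (t : complexBetti S (2 * 1) →ₗ[ℂ] complexBetti S (2 * 1))
    (ht_rat : ∀ y, IsRationalClass y → IsRationalClass (t y))
    (ht_typ : ∀ (a b : ℕ) (y : complexBetti S (2 * 1)),
      IsOfHodgeType 2 S (2 * 1) a b y → IsOfHodgeType 2 S (2 * 1) a b (t y))
    (ht_cyc : ∃ γ ∈ algebraicClasses (S ⊗ S) 2, ∀ y : complexBetti S (2 * 1),
      t y = corrAction complexOrientationFamily (IsK3Surface.isSmoothProjective hS)
        (IsK3Surface.isSmoothProjective hS) (rfl : 2 * 1 + 2 * 2 = 2 * 1 + 2 * 2) γ y)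
    (hgen : TranscendentalEndomorphismsGeneratedBy S t) :
    HodgeConjectureFor 4 H :=
  hodgeConjectureFor_hilbertSquare_of_cycleInducedGenerator hV hO (qInvAlgebraic_of_charlesMarkman hV hB) hS hM
    hxpos hH hK hMH hθ hi t ht_rat ht_typ ht_cyc hgen

/-! ### §4 Every Hilbert square of `S`, from Beauville's marked incidence -/

/-- **HC⁴ for EVERY Hilbert square of a marked projective K3 surface carrying a rational, type-preserving,
cycle-induced, generating endomorphism — the `X`-side road** (Beauville's fact supplies one marked Hilbert
square with algebraic incidence; any representing pair of `Hilb²(S)` is isomorphic to it,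
`IsHilbertSchemeOfPoints.exists_iso`, and HC descends along the isomorphism). Modulo {Beauville marked incidence,
Verbitsky–Guan, O'Grady, Charles–Markman}; a SECOND road to `hodgeConjectureFor_hilbertSquare_of_rmSpreadFamily`
(Beauville–Fogarty only), not a new case. [cite: Beauville1983, §6 Prop. 6 and Remarque]
[cite: CharlesMarkman2013, Thm. 1.1 (§1)] [cite: OGrady2008NumericalK3Square, §3] [cite: GeemenSchutt2023, §4.8] -/
theorem hodgeConjectureFor_hilbertSquare_of_cycleInducedGenerator_of_facts
    (hBI : Beauville1983_hilbertSquare_markedIncidence) (hV : VerbitskyGuan_cohomology_K3HilbertSquareType)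
    (hO : OGrady2008_dualBBFClass_algebraic) (hB : CharlesMarkman2013_lefschetzStandard_K3HilbertType)
    (hS : IsK3Surface S) (hM : MarkedK3[S, η, p, x]) (hx0 : k3Form x x = 0)
    (hxpos : 0 < (k3Form (star x) x).re)
    (hproj : ∃ u : K3Index → ℤ, k3Form (fun i => (u i : ℂ)) x = 0 ∧ 0 < ∑ i, ∑ j, u i * k3Gram i j * u j)
    (t : complexBetti S (2 * 1) →ₗ[ℂ] complexBetti S (2 * 1))
    (ht_rat : ∀ y, IsRationalClass y → IsRationalClass (t y))
    (ht_typ : ∀ (a b : ℕ) (y : complexBetti S (2 * 1)),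
      IsOfHodgeType 2 S (2 * 1) a b y → IsOfHodgeType 2 S (2 * 1) a b (t y))
    (ht_cyc : ∃ γ ∈ algebraicClasses (S ⊗ S) 2, ∀ y : complexBetti S (2 * 1),
      t y = corrAction complexOrientationFamily (IsK3Surface.isSmoothProjective hS)
        (IsK3Surface.isSmoothProjective hS) (rfl : 2 * 1 + 2 * 2 = 2 * 1 + 2 * 2) γ y)
    (hgen : TranscendentalEndomorphismsGeneratedBy S t)
    {H' : SchemeOver ℂ} {Ξ' : (S ⊗ H').left.IdealSheafData}
    (hHilb' : HilbertScheme.IsHilbertSchemeOfPoints 2 S H' Ξ') (hH' : IsSmoothProjective 4 H') :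
    HodgeConjectureFor 4 H' := by
  obtain ⟨H, hH, Ξ, φH, PH, hHilb, hK, hMH, θ, hθ, hi⟩ :=
    hBI complexOrientationFamily hasPoincareDuality_complexOrientationFamily S hS η p x hM hx0 hxpos hproj
  have hHC : HodgeConjectureFor 4 H :=
    hodgeConjectureFor_hilbertSquare_of_cycleInducedGenerator_of_charlesMarkman hV hO hB hS hM hxpos hH hK hMH hθ
      hi t ht_rat ht_typ ht_cyc hgen
  obtain ⟨e, -, -⟩ := hHilb.exists_iso hHilb'
  exact hHC.of_surjective hH hH' e.hom

end Summit.HodgeConjecture.HodgeConjecture.Theorems.MarkmanPartnerTransport.PartnerLattice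

end
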